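import Summits.HodgeConjecture.HodgeConjecture.Theses.GmtVisibleFractionBootstrap

/-!
# Birth skeleton (BC3) — crux `RemainderPositivity` of route `GmtVisibleFractionBootstrap`

Crux item `stmt-HodgeConjecture-18331`, decl
`Summit.HodgeConjecture.HodgeConjecture.Theses.GmtVisibleFractionBootstrap.RemainderPositivity`
(K3 of the route, rank 3): for every setup `(A, S : KaehlerEmbedding A V, p + q = n, 1 ≤ p ≤ q)`,
every rational class `c₀` represented on `A` by a smooth strictly strongly positive `2p`-form `α`,
every sequence of mass-minimizing integral currents `T j ∈ (k j)·PD[α]` with `k j → ∞`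
(representable, with measurable openly-holomorphic loci) and every current `R` which is the weak
limit of the NORMALISED NON-HOLOMORPHIC REMAINDERS `(T j - T j ⌞ hol⁺(T j)) / k j`, the periods of
`R` on ambient test forms closed along `ι` are limits of the periods `∫ β i ∧ ι^*Φ` of smooth CLOSED
STRICTLY strongly positive `2p`-forms `β i` on `A` — "the class of the blown-down remainder lies in
the closure of Lawson's cone `K^p`".

## The seam — regularity of the free part / mass accounting / the positivity core

The mechanism of the route (module docstring of the route file, TWO-LAYER PLAN) is split at the two
places where the nature of the argument changes:

* `stub_holomorphicPart_closedPositive` — **(R) regularity of the free part** (statement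
  `HolomorphicPartClosedPositive`): for every minimizer `T ∈ k·PD[α]`, the restriction
  `T ⌞ hol⁺(T)` to its openly holomorphic locus is a CYCLE and is a POSITIVE current along `ι`.
  Positivity is local from the definition of `holLocus`; closedness is the deep input — Morrey's
  interior analyticity of mass minimizers and unique continuation of the complex-tangency condition
  along the connected regular set, so the frontier of `hol⁺(T)` inside `spt T` lies in Almgren's
  singular set (Hausdorff codimension `≥ 2`), across which a flat `(2q-1)`-current vanishes
  (Federer 4.1.20) / a positive holomorphic chain extends (Harvey–Shiffman, King). These are two of
  the seven conjuncts of the route's support `FreeCycles` (stmt-HodgeConjecture-18332), WITHOUT Chow /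
  algebraicity and without the size identity: whoever proves `FreeCycles` proves this stub en route.
  [cite: Almgren2000] [cite: Morrey1958AnalyticityI] [cite: HarveyShiffman1974] [cite: King1971]
  [cite: Federer1969, 4.1.20 and 4.1.31]
* `stub_remainderLimit_positiveCycle` — **(M) mass accounting** (statement
  `HolomorphicPartClosedPositive → RemainderLimitPositiveCycle`): GIVEN (R), every blown-down remainder
  limit `R` is a closed current of finite mass carried by `ι(X^an)` which is STRONGLY positive along
  `ι` (non-negative on every ambient test form whose pull-back is pointwise WEAKLY positive,
  `IsStronglyPositiveAlong`). Mechanism: Federer's stable-norm theorem (`𝐌(T j)/k j → size α`, the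
  real mass norm of `PD[α]`, which for a strictly strongly positive `α` is `∫ α ∧ ω^q/q!` by
  Wirtinger) + lower semicontinuity of mass + additivity of `‖T j‖` over `hol⁺(T j)` and its
  complement + calibration of the holomorphic part give `𝐌(R) ≤ R(Ω_q)` for an ambient form `Ω_q`
  restricting to `ω^q/q!` on `ι(X^an)`; a normal current carried by the submanifold `ι(X^an)` is
  tangential (Federer 4.1.15), so `R` is CALIBRATED by `ω^q/q!`, and the equality case of
  Wirtinger's inequality for the mass norm (Harvey–Knapp) says its tangent `2q`-vector field is
  strongly positive `‖R‖`-a.e.; `∂R = -lim ∂(T j ⌞ hol⁺)/k j = 0` by (R); `spt R ⊆ ι(X^an)` (closed).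
  Classical GMT, no regularity theory beyond (R). [cite: Federer1974RealFlatChains, §5]
  [cite: HarveyKnapp1974, §1 and Cor. 1.10] [cite: Federer1969, 4.1.7, 4.1.15, 4.2.17, 5.4.19]
* `stub_remainderClass_inClosedStrictCone` — **(P) the positivity core** (statement
  `RemainderClassInClosedCone`): GIVEN that the remainder limit `R` of a minimizing sequence is a
  strongly positive cycle of finite mass along `ι` (the output of (M)), its periods are limits of
  periods of smooth closed strictly strongly positive forms. This is the crux's open content and
  carries its recorded risk verbatim (why it might fail: the class `[R] = [α] - lim [hol⁺(T j)]/k j`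
  might leave `closure K^p` — nef-not-psef / weak-vs-strong phenomena in codimension `≥ 2`,
  Debarre–Ein–Lazarsfeld–Voisin arXiv:1003.3183 Problem 6.3, Babaee–Huh 2017). Design note (why the
  interface is NOT an intrinsic regularisation lemma): "a strongly positive closed `(p,p)`-current
  with vanishing Lelong numbers has class in `closure K^p`" is Demailly's 1992 regularisation theorem
  for `p = 1` but is FALSE for `p = q = 2` (the translation-average of the `2`-planes of the
  exceptional `ℙ³ ⊂ Bl_pt Y⁴` is strongly positive, closed, Lelong-free, and its class `[Π]` has
  `[Π]·[Π'] = -1`), and "charging no proper analytic subset" fails already for `p = 1, n = 3`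
  (modified-nef, non-nef big classes); so the honest core keeps the variational provenance
  (minimizers of `k·PD[α]`, `α` STRICTLY positive, holomorphic part removed) together with the
  intrinsic shape delivered by (M). [cite: Demailly1992] [cite: BabaeeHuh2017] [cite: DELV2011, Problem 6.3]

`RemainderPositivity_of` is the real (sorry-free) composition (M)∘(R) feeds (P); it concludes the
route decl BY NAME. No stub alone gives the crux ((R) and (M) do not mention the forms `β`, (P)
needs the shape of `R`) nor the summit `_root_.HodgeConjecture`; BC3 probes
(`stub → RemainderPositivity`, `stub → HodgeConjecture` by
`first | exact? | simpa [·] | (unfold ·; simpa) | aesop`) are run in the sibling probe files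
`bc/RemainderPositivity_probe_*.lean` and must fail.

Disproof used: none — the crux has no `Disproof.lean`, no `_false_without_` theorem, no landed
`Negative/` lemma (`ledger crux ls stmt-HodgeConjecture-18331`: no workfiles, 2026-08-17).
Dead lines: none recorded. Negatives index of the summit (MilnorKExponential, DerivedTorelliFermat,
ELineTransport refutations) is disjoint from these statements.
-/

-- every declaration of this problem lives in `Summit.HodgeConjecture.HodgeConjecture.…` (summit =
-- sub-problem), which `linter.dupNamespace` flags
set_option linter.dupNamespace false

namespace Summit.HodgeConjecture.HodgeConjecture.Cruxes.RemainderPositivity.Birth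

open scoped Topology Manifold ENNReal
open Filter Set TopologicalSpace MeasureTheory
open Literature.AlgebraicGeometry.HodgeTheory Literature.Geometry.Kaehler
  Literature.Geometry.GeometricMeasureTheory Literature.NumberTheory.Transcendental
open Summit.HodgeConjecture.HodgeConjecture.Theses.GmtVisibleFractionBootstrap (RemainderPositivity)

/-! ## Interface notions (stated over existing declarations) -/

/-- **Weak positivity of a real `2q`-covector** on a complex normed space `E` (Harvey–Knapp, §1;
Demailly, *Complex analytic and differential geometry* III.1.1): its pull-back along every `ℂ`-linear
map `L : ℂ^q → E` is a NON-NEGATIVE multiple of the volume form `K_q = ω₀^q/q!` of `ℂ^q`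
(`Literature.Geometry.Kaehler.kaehlerPow`), i.e. it is `≥ 0` on every canonically oriented complex
`q`-plane. The weakly positive cone is the dual of the strongly positive cone of `2q`-vectors.
[cite: HarveyKnapp1974, §1] -/
def IsWeaklyPositiveCovector (E : Type*) [NormedAddCommGroup E] [NormedSpace ℂ E] (q : ℕ)
    (u : E [⋀^Fin (2 * q)]→L[ℝ] ℝ) : Prop :=
  ∀ L : EuclideanSpace ℂ (Fin q) →L[ℂ] E, ∃ c : ℝ, 0 ≤ c ∧
    u.compContinuousLinearMap (L.restrictScalars ℝ) =
      c • (kaehlerPow (V := EuclideanSpace ℂ (Fin q)) q)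

variable {n : ℕ} {X : Literature.AlgebraicGeometry.Motives.SchemeOver ℂ} {A : HodgeModel n X}
  {V : Type} [NormedAddCommGroup V] [InnerProductSpace ℝ V] [FiniteDimensional ℝ V]
  [MeasurableSpace V] [BorelSpace V]

/-- **`R` is a strongly positive current along `ι`**: `R(Φ) ≥ 0` for every ambient test `2q`-form
whose pull-back `ι^*Φ` is pointwise weakly positive. For a current carried by `ι(X^an)` with
tangential tangent `2q`-vectors this says: `‖R‖`-a.e. the tangent `2q`-vector lies in the closed
convex cone spanned by the canonically oriented complex `q`-planes (in particular `R` has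
bidimension `(q,q)`), e.g. a current calibrated by `ω^q/q!` (Harvey–Knapp, equality in Wirtinger's
inequality for the mass norm). [cite: HarveyKnapp1974, §1 and Cor. 1.10] -/
def IsStronglyPositiveAlong (S : KaehlerEmbedding A V) (q : ℕ)
    (R : Current (⊤ : Opens V) (2 * q)) : Prop :=
  ∀ Φ : TestForm (⊤ : Opens V) (2 * q),
    (∀ x : A.carrier, IsWeaklyPositiveCovector A.model q
      ((S.pullbackForm Φ) x : A.model [⋀^Fin (2 * q)]→L[ℝ] ℝ)) → 0 ≤ R Φ

/-- **The intrinsic shape of a blown-down remainder**: a CYCLE, carried by `ι(X^an)`, of FINITE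
mass, STRONGLY positive along `ι`. [cite: Federer1969, 4.1.7 and 4.1.15] -/
def IsPositiveCycleAlong (S : KaehlerEmbedding A V) (q : ℕ)
    (R : Current (⊤ : Opens V) (2 * q)) : Prop :=
  R.IsCycle ∧ R.support ⊆ Set.range S.toFun ∧ R.mass ≠ ⊤ ∧ IsStronglyPositiveAlong S q R

/-! ## The three statements -/

/-- **Statement (R) — the openly holomorphic part of a minimizer is a closed positive current.**
For every setup, every datum `(c₀, α)` as in the crux, every `k` and every mass minimizer
`T ∈ k·PD[α]` which is representable with measurable holomorphic locus, `T ⌞ hol⁺(T)` is a cycle and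
is non-negative on test forms positive along `ι`. Two conjuncts of the route's support `FreeCycles`
(same binders), without algebraicity. [cite: Almgren2000] [cite: Morrey1958AnalyticityI]
[cite: HarveyShiffman1974] [cite: King1971] [cite: Federer1969, 4.1.20 and 4.1.31] -/
def HolomorphicPartClosedPositive : Prop :=
  ∀ (n : ℕ) (X : Literature.AlgebraicGeometry.Motives.SchemeOver ℂ) (A : HodgeModel n X)
    [Fact (Module.finrank ℝ A.model = 2 * n)] [MeasurableSpace A.model] [BorelSpace A.model]
    (V : Type) [NormedAddCommGroup V] [InnerProductSpace ℝ V] [FiniteDimensional ℝ V]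
    [MeasurableSpace V] [BorelSpace V] (S : KaehlerEmbedding A V) (p q : ℕ) (hpq : p + q = n),
    1 ≤ p → p ≤ q →
    ∀ (c₀ : complexBetti X (2 * p)) (α : MForm 𝓘(ℝ, A.model) A.carrier ℝ (2 * p)),
      IsRationalClass c₀ → A.FormRepresents (2 * p) α c₀ → IsSmoothForm α →
      IsStrictlyPositiveForm p α →
      ∀ (k : ℕ) (T : Current (⊤ : Opens V) (2 * q)), S.IsMassMinimizing hpq α k T →
        ∀ (hT : T.IsRepresentable) (hm : MeasurableSet (S.holLocus p T)),
          (hT.restrictSet _ hm).IsCycle ∧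
            ∀ Φ : TestForm (⊤ : Opens V) (2 * q), S.IsPositiveTestForm q Φ →
              0 ≤ hT.restrictSet _ hm Φ

/-- **Statement (M) — blown-down remainder limits are strongly positive cycles of finite mass
along `ι`.** Under exactly the hypotheses of the crux (setup, datum, minimizing sequence with
`k j → ∞`, representable, measurable holomorphic loci, `R` the weak limit of the normalised
remainders), `IsPositiveCycleAlong S q R`. Registered as an implication from (R)
(`stub_remainderLimit_positiveCycle : HolomorphicPartClosedPositive → RemainderLimitPositiveCycle`):
Federer's stable norm theorem, Wirtinger's inequality and its equality case for the mass norm,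
lower semicontinuity of mass, tangentiality of normal currents carried by a submanifold.
[cite: Federer1974RealFlatChains, §5] [cite: HarveyKnapp1974, Cor. 1.10]
[cite: Federer1969, 4.1.7, 4.1.15, 4.2.17 and 5.4.19] -/
def RemainderLimitPositiveCycle : Prop :=
  ∀ (n : ℕ) (X : Literature.AlgebraicGeometry.Motives.SchemeOver ℂ) (A : HodgeModel n X)
    [Fact (Module.finrank ℝ A.model = 2 * n)] [MeasurableSpace A.model] [BorelSpace A.model]
    (V : Type) [NormedAddCommGroup V] [InnerProductSpace ℝ V] [FiniteDimensional ℝ V]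
    [MeasurableSpace V] [BorelSpace V] (S : KaehlerEmbedding A V) (p q : ℕ) (hpq : p + q = n),
    1 ≤ p → p ≤ q →
    ∀ (c₀ : complexBetti X (2 * p)) (α : MForm 𝓘(ℝ, A.model) A.carrier ℝ (2 * p)),
      IsRationalClass c₀ → A.FormRepresents (2 * p) α c₀ → IsSmoothForm α →
      IsStrictlyPositiveForm p α →
      ∀ (k : ℕ → ℕ) (T : ℕ → Current (⊤ : Opens V) (2 * q)), Tendsto k atTop atTop →
        (∀ j, S.IsMassMinimizing hpq α (k j) (T j)) →
        ∀ (hT : ∀ j, (T j).IsRepresentable) (hm : ∀ j, MeasurableSet (S.holLocus p (T j)))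
          (R : Current (⊤ : Opens V) (2 * q)),
          (∀ Φ, Tendsto (fun j ↦ ((T j) Φ - (hT j).restrictSet _ (hm j) Φ) / (k j)) atTop
            (𝓝 (R Φ))) →
          IsPositiveCycleAlong S q R

/-- **Statement (P) — the positivity core: the class of a strongly positive remainder cycle lies in
the closed strictly-positive form cone.** Under the hypotheses of the crux AND the shape delivered by
(M) (`IsPositiveCycleAlong S q R`), there are smooth closed strictly strongly positive `2p`-forms
`β i` on `A` whose periods `∫ β i ∧ ι^*Φ` converge to `R(Φ)` for every ambient test form closed
along `ι`. The open content of K3 (Lawson's Conj. 5.15 mechanism; risk: DELV Problem 6.3 /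
Babaee–Huh-type classes). [cite: Lawson1975MinimalVarieties, Conj. 5.15 and p. 206]
[cite: DELV2011, Problem 6.3] [cite: BabaeeHuh2017] [cite: Demailly1992] -/
def RemainderClassInClosedCone : Prop :=
  ∀ (n : ℕ) (X : Literature.AlgebraicGeometry.Motives.SchemeOver ℂ) (A : HodgeModel n X)
    [Fact (Module.finrank ℝ A.model = 2 * n)] [MeasurableSpace A.model] [BorelSpace A.model]
    (V : Type) [NormedAddCommGroup V] [InnerProductSpace ℝ V] [FiniteDimensional ℝ V]
    [MeasurableSpace V] [BorelSpace V] (S : KaehlerEmbedding A V) (p q : ℕ) (hpq : p + q = n),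
    1 ≤ p → p ≤ q →
    ∀ (c₀ : complexBetti X (2 * p)) (α : MForm 𝓘(ℝ, A.model) A.carrier ℝ (2 * p)),
      IsRationalClass c₀ → A.FormRepresents (2 * p) α c₀ → IsSmoothForm α →
      IsStrictlyPositiveForm p α →
      ∀ (k : ℕ → ℕ) (T : ℕ → Current (⊤ : Opens V) (2 * q)), Tendsto k atTop atTop →
        (∀ j, S.IsMassMinimizing hpq α (k j) (T j)) →
        ∀ (hT : ∀ j, (T j).IsRepresentable) (hm : ∀ j, MeasurableSet (S.holLocus p (T j)))
          (R : Current (⊤ : Opens V) (2 * q)),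
          (∀ Φ, Tendsto (fun j ↦ ((T j) Φ - (hT j).restrictSet _ (hm j) Φ) / (k j)) atTop
            (𝓝 (R Φ))) →
          IsPositiveCycleAlong S q R →
          ∃ β : ℕ → MForm 𝓘(ℝ, A.model) A.carrier ℝ (2 * p),
            (∀ i, IsSmoothForm (β i) ∧ IsClosedForm (β i) ∧ IsStrictlyPositiveForm p (β i)) ∧
              ∀ Φ : TestForm (⊤ : Opens V) (2 * q), IsClosedForm (S.pullbackForm Φ) →
                Tendsto (fun i ↦ S.pairing hpq (β i) Φ) atTop (𝓝 (R Φ))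

/-! ## The registered stubs -/

/-- Stub (R): the openly holomorphic part of a mass minimizer in `k·PD[α]` is a closed positive
current (Almgren–Morrey–Harvey–Shiffman–King; shared with `FreeCycles`). [cite: Almgren2000]
[cite: HarveyShiffman1974] [cite: King1971] -/
theorem stub_holomorphicPart_closedPositive : HolomorphicPartClosedPositive := by
  sorry

/-- Stub (M): given (R), blown-down remainder limits are strongly positive cycles of finite mass
along `ι` (Federer's stable norm + Wirtinger equality case). [cite: Federer1974RealFlatChains, §5]
[cite: HarveyKnapp1974, Cor. 1.10] -/
theorem stub_remainderLimit_positiveCycle :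
    HolomorphicPartClosedPositive → RemainderLimitPositiveCycle := by
  sorry

/-- Stub (P): the positivity core — the class of the strongly positive remainder cycle of a
minimizing sequence lies in the closure of the strictly strongly positive form cone.
[cite: Lawson1975MinimalVarieties, Conj. 5.15] [cite: DELV2011, Problem 6.3] -/
theorem stub_remainderClass_inClosedStrictCone : RemainderClassInClosedCone := by
  sorry

/-! ## Name-keyed aliases of the stub statements — the hypotheses of `RemainderPositivity_of`
The native skeleton audit (`#h21_check_skeleton`) admits a hypothesis of the skeleton theorem only if
its head constant is a registered obligation or is NAMED like a declared stub; `__Registered.stub_X`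
is the statement of stub `X` under the stub's short name (device of
`Cruxes/AlgebraicDensity/Lines/birth.lean`). -/
namespace __Registered

/-- Alias of `HolomorphicPartClosedPositive` keyed by the registered stub name. -/
abbrev stub_holomorphicPart_closedPositive : Prop := HolomorphicPartClosedPositive
/-- Alias of `HolomorphicPartClosedPositive → RemainderLimitPositiveCycle` keyed by the stub name. -/
abbrev stub_remainderLimit_positiveCycle : Prop :=
  HolomorphicPartClosedPositive → RemainderLimitPositiveCycle
/-- Alias of `RemainderClassInClosedCone` keyed by the registered stub name. -/
abbrev stub_remainderClass_inClosedStrictCone : Prop := RemainderClassInClosedCone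

end __Registered

/-- **Composition (real proof) — THE SKELETON THEOREM.** (R) discharges the hypothesis of (M); (M)
delivers the shape `IsPositiveCycleAlong S q R` of the remainder limit; (P) turns it into the period
approximation by smooth closed strictly positive forms. Hypotheses = the three stub statements
(name-keyed aliases); concludes the route decl `RemainderPositivity` BY NAME. -/
theorem RemainderPositivity_of :
    __Registered.stub_holomorphicPart_closedPositive →
      __Registered.stub_remainderLimit_positiveCycle →
        __Registered.stub_remainderClass_inClosedStrictCone → RemainderPositivity := by
  intro h0 h1 h2 n X A _ _ _ V _ _ _ _ _ S p q hpq hp hpq' c₀ α hc hrep hsm hpos k T hk hmin hT hm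
    R hR
  exact h2 n X A V S p q hpq hp hpq' c₀ α hc hrep hsm hpos k T hk hmin hT hm R hR
    (h1 h0 n X A V S p q hpq hp hpq' c₀ α hc hrep hsm hpos k T hk hmin hT hm R hR)

/-- **The crux, closed modulo exactly the three registered stubs** (sanity: the stubs compose). -/
theorem RemainderPositivity_of_stubs : RemainderPositivity :=
  RemainderPositivity_of stub_holomorphicPart_closedPositive stub_remainderLimit_positiveCycle
    stub_remainderClass_inClosedStrictCone

end Summit.HodgeConjecture.HodgeConjecture.Cruxes.RemainderPositivity.Birth
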